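import Summits.Ventures.PercRepro.ProfileGapMonoColoopQ
import Summits.Ventures.PercRepro.ProfileGapMonoTwoRow
import Summits.Ventures.PercRepro.ProfileGapMonoTopButOne

/-!
# PercRepro — THE COLOOP CASE OF `(GM)_q` IN THE REGIME `ρ(M ∖ z) ≥ u + q`, FOR EVERY `q`, FROM TWO ROWS OF
`M ∖ z` (p5, gen 22; `proofs/P5-GM1.md` §11 + §14 supplement; announced INBOX 10455)

In `(★_q)` (ProfileGapMonoColoopQ), with `N := M ∖ z` and `ρ(N) ≥ u + q`, submodularity
`ρ(B) + ρ(E' ∖ B) ≥ ρ(N)` gives: (i) no rank-`q` set has a complement of rank `u − 1` (it is `≥ u`) — the first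
left-hand term vanishes; (ii) every rank-`(q−1)` set has a complement of rank `≥ u + 1`, so the left-hand sum is
exactly the demand `D_{q−1}(N; u−1)` of the row `(q − 1, u − 1)`; (iii) every rank-`(u−1)` set has a complement of
rank `≥ q + 1`, so `levelSetCoQ N (q−1) (u−1) = levelSetCoQ N q (u−1) = levelSet N (u−1)`.  Hence
`(★_q)` follows from the row `Π⁻_{q−1,u−1}(N)` alone (the `lostSets` term is dropped), and with the coloop
identity `gapMonoQ_of_coloop_of_starQ`, **`(GM)_q` at a coloop `z` with `ρ(M ∖ z) ≥ u + q` follows from the rows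
`(q, u−1)` and `(q−1, u−1)` of `M ∖ z`** — both available to a strong induction on `#E`.  For `q = 3` the second row
is the tree theorem `profileIneqMinusQ_two_all`.  At the top-but-one level `u = ρ(M ∖ z)` the inequality `(★_q)`
holds UNCONDITIONALLY for every `q` (`starQ_of_rk_eq`: the demand through the coloop is `C(u,q)` per rank-`(q−1)`
set with spanning complement, and these are the lost sets under `B' ↦ E' ∖ B'`), so there `(GM)_q` at a coloop needs
only the row `(q, u−1)` of `M ∖ z`.

* `filter_Rq_rk_sdiff_eq_empty_of_rk`, `sum_Rq_pred_choose_eq_sum_demand_of_rk`, `filter_levelSetCoQ_pred_eq_lostSets`,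
  `choose_sdiff_eq_ite_of_rk_eq`, **`starQ_of_rk_eq`** (`(★_q)` at `u = ρ(M ∖ z)`, unconditional), `gapMonoQ_of_coloop_top_but_one`,
  `profileIneqMinusQ_of_coloop_top_but_one`;
* **`starQ_of_row_regime`**, **`gapMonoQ_of_coloop_regime`**, `gapMonoQ_of_coloop_regime'`,
  **`gapMonoQ_three_of_coloop_regime`**, `profileIneqMinusQ_of_coloop_regime`.
-/

open scoped Matroid

namespace PercRepro.Cogirth

open Finset ThmH Skew Shadow Profile

variable {α : Type} [DecidableEq α] {M : Matroid α} [M.Finite]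

section Regime

variable {N : Matroid α} [N.Finite] {q u : ℕ}

/-- In the regime `ρ(E) ≥ u + q` (with `q < u`) no rank-`q` set has a complement of rank `u − 1`. -/
theorem filter_Rq_rk_sdiff_eq_empty_of_rk (hqu : q < u) (hR : u + q ≤ rk N (gr N)) :
    (Rq N q).filter (fun B => rk N (gr N \ B) = u - 1) = ∅ := by
  rw [filter_eq_empty_iff]
  intro B hB
  rw [mem_Rq] at hB
  have hBr : rk N B = q := rk_eq_of_eRk_eq_cq hB.2
  have h := rk_gr_le_rk_add_rk_sdiff (M := N) B
  omega

/-- In the regime `ρ(E) ≥ u + q` every rank-`(q−1)` set has a complement of rank `≥ u + 1`, so the demand through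
a coloop is exactly the demand of the row `(q − 1, u − 1)`. -/
theorem sum_Rq_pred_choose_eq_sum_demand_of_rk (hq : 1 ≤ q) (hqu : q < u) (hR : u + q ≤ rk N (gr N)) :
    ∑ B' ∈ Rq N (q - 1), (if u ≤ rk N (gr N \ B') then (rk N (gr N \ B')).choose (u - q) else 0) =
      ∑ B' ∈ Rq N (q - 1), demand N (q - 1) (u - 1) B' := by
  refine sum_congr rfl (fun B' hB' => ?_)
  rw [mem_Rq] at hB'
  have hBr : rk N B' = q - 1 := rk_eq_of_eRk_eq_cq hB'.2
  have h := rk_gr_le_rk_add_rk_sdiff (M := N) B'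
  have hm : u ≤ rk N (gr N \ B') := by omega
  have hm' : u - 1 ≤ rk N (gr N \ B') := by omega
  have hsub : u - 1 - (q - 1) = u - q := by omega
  unfold demand
  rw [if_pos hm, if_pos hm', hsub]

/-- The lost sets are the co-rank-`(q−1)` rank-`u` sets whose complement has rank exactly `q − 1`. -/
theorem filter_levelSetCoQ_pred_eq_lostSets (q u : ℕ) :
    (levelSetCoQ N (q - 1) u).filter (fun S => rk N (gr N \ S) = q - 1) = lostSets N q u := by
  unfold lostSets levelSetCoQ
  rw [filter_filter]
  refine filter_congr (fun S _ => ?_)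
  constructor
  · exact fun h => h.2
  · exact fun h => ⟨h.symm.le, h⟩

/-- At the level `u = ρ(E)`: a rank-`(q−1)` set demands `C(u,q)` exactly when its complement spans. -/
theorem choose_sdiff_eq_ite_of_rk_eq (hqu : q < u) (hR : rk N (gr N) = u) {B' : Finset α} :
    (if u ≤ rk N (gr N \ B') then (rk N (gr N \ B')).choose (u - q) else 0) =
      (if rk N (gr N \ B') = u then u.choose q else 0) := by
  have hle : rk N (gr N \ B') ≤ u := by
    rw [← hR]
    exact rk_mono' sdiff_subset
  by_cases h : rk N (gr N \ B') = u
  · rw [if_pos (h ▸ le_refl _), if_pos h, h, Nat.choose_symm hqu.le]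
  · rw [if_neg (fun h' => h (le_antisymm hle h')), if_neg h]

end Regime

section Coloop

variable {z : α} {q u : ℕ}

/-- **`(★_q)` in the regime `ρ(M ∖ z) ≥ u + q`** follows from the row `(q − 1, u − 1)` of `M ∖ z` alone
(no coloop hypothesis: `StarQ` is a statement about `M ∖ z`). -/
theorem starQ_of_row_regime (hq : 1 ≤ q) (hqu : q < u)
    (hR : u + q ≤ rk (M ＼ ({z} : Set α)) (gr (M ＼ ({z} : Set α))))
    (h : ProfileIneqMinusQ (M ＼ ({z} : Set α)) (q - 1) (u - 1)) : StarQ M z q u := by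
  unfold StarQ
  rw [filter_Rq_rk_sdiff_eq_empty_of_rk hqu hR, card_empty, mul_zero, zero_add,
    sum_Rq_pred_choose_eq_sum_demand_of_rk hq hqu hR]
  unfold ProfileIneqMinusQ at h
  have h1 : levelSetCoQ (M ＼ ({z} : Set α)) (q - 1) (u - 1) = levelSet (M ＼ ({z} : Set α)) (u - 1) :=
    levelSetCoQ_eq_levelSet_of_rk (by omega)
  have h2 : levelSetCoQ (M ＼ ({z} : Set α)) q (u - 1) = levelSet (M ＼ ({z} : Set α)) (u - 1) :=
    levelSetCoQ_eq_levelSet_of_rk (by omega)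
  rw [h1] at h
  rw [h2]
  exact le_add_right h

/-- **`(★_q)` at the top-but-one level `u = ρ(M ∖ z)` holds unconditionally**, for every `q`: the demand through
the coloop is `C(u,q)` times the number of rank-`(q−1)` sets with spanning complement, which is the number of lost
sets (`B' ↦ E' ∖ B'`), and the rank-`q` sets with a complement of rank `u − 1` inject into `levelSetCoQ` by the same
map. -/
theorem starQ_of_rk_eq (hqu : q < u)
    (hR : rk (M ＼ ({z} : Set α)) (gr (M ＼ ({z} : Set α))) = u) : StarQ M z q u := by
  unfold StarQ
  rw [sum_congr rfl (fun B' _ => choose_sdiff_eq_ite_of_rk_eq hqu hR (B' := B')), sum_ite, sum_const_zero,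
    add_zero, sum_const, smul_eq_mul, card_filter_Rq_eq_card_filter_levelSetCoQ (q - 1) u,
    filter_levelSetCoQ_pred_eq_lostSets, card_filter_Rq_eq_card_filter_levelSetCoQ q (u - 1)]
  have hF := card_filter_le (levelSetCoQ (M ＼ ({z} : Set α)) q (u - 1))
    (fun S => rk (M ＼ ({z} : Set α)) (gr (M ＼ ({z} : Set α)) \ S) = q)
  nlinarith [hF, Nat.zero_le ((u - 1).choose (q - 1))]

/-- **`(GM)_q` at a coloop at the top-but-one level `u = ρ(M ∖ z) = ρ(E) − 1`**, from the row `(q, u−1)` of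
`M ∖ z` alone, for every `q`. -/
theorem gapMonoQ_of_coloop_top_but_one (hz : z ∈ gr M) (hzc : rk M ((gr M).erase z) + 1 = rk M (gr M))
    (hq : 1 ≤ q) (hqu : q < u) (hR : rk (M ＼ ({z} : Set α)) (gr (M ＼ ({z} : Set α))) = u)
    (h1 : ProfileIneqMinusQ (M ＼ ({z} : Set α)) q (u - 1)) : GapMonoQ M z q u :=
  gapMonoQ_of_coloop_of_starQ hz hzc hq hqu h1 (starQ_of_rk_eq hqu hR)

/-- **The row `(q, u)` of `M` at a coloop at the top-but-one level**, from the rows `(q, u)` and `(q, u−1)` of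
`M ∖ z`. -/
theorem profileIneqMinusQ_of_coloop_top_but_one (hz : z ∈ gr M)
    (hzc : rk M ((gr M).erase z) + 1 = rk M (gr M)) (hq : 1 ≤ q) (hqu : q < u)
    (hR : rk (M ＼ ({z} : Set α)) (gr (M ＼ ({z} : Set α))) = u)
    (h0 : ProfileIneqMinusQ (M ＼ ({z} : Set α)) q u)
    (h1 : ProfileIneqMinusQ (M ＼ ({z} : Set α)) q (u - 1)) : ProfileIneqMinusQ M q u :=
  profileIneqMinusQ_of_gapMonoQ (gapMonoQ_of_coloop_top_but_one hz hzc hq hqu hR h1) h0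

/-- **`(GM)_q` at a coloop in the regime `ρ(M ∖ z) ≥ u + q`**, from the rows `(q, u−1)` and `(q−1, u−1)` of
`M ∖ z`. -/
theorem gapMonoQ_of_coloop_regime (hz : z ∈ gr M) (hzc : rk M ((gr M).erase z) + 1 = rk M (gr M))
    (hq : 1 ≤ q) (hqu : q < u) (hR : u + q ≤ rk (M ＼ ({z} : Set α)) (gr (M ＼ ({z} : Set α))))
    (h1 : ProfileIneqMinusQ (M ＼ ({z} : Set α)) q (u - 1))
    (h2 : ProfileIneqMinusQ (M ＼ ({z} : Set α)) (q - 1) (u - 1)) : GapMonoQ M z q u :=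
  gapMonoQ_of_coloop_of_starQ hz hzc hq hqu h1 (starQ_of_row_regime hq hqu hR h2)

/-- `gapMonoQ_of_coloop_regime` with the regime written on `M`: `ρ(E) ≥ u + q + 1` (the tree's
`rk_gr_delete_coloop`). -/
theorem gapMonoQ_of_coloop_regime' (hz : z ∈ gr M) (hzc : rk M ((gr M).erase z) + 1 = rk M (gr M))
    (hq : 1 ≤ q) (hqu : q < u) (hR : u + q + 1 ≤ rk M (gr M))
    (h1 : ProfileIneqMinusQ (M ＼ ({z} : Set α)) q (u - 1))
    (h2 : ProfileIneqMinusQ (M ＼ ({z} : Set α)) (q - 1) (u - 1)) : GapMonoQ M z q u :=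
  gapMonoQ_of_coloop_regime hz hzc hq hqu (by have := rk_gr_delete_coloop (M := M) hzc; omega) h1 h2

/-- **`(GM)_3` at a coloop in the regime `ρ(M ∖ z) ≥ u + 3`**, from the co-rank-`3` row of `M ∖ z` at level `u − 1`
alone (the co-rank-`2` row is the tree theorem `profileIneqMinusQ_two_all`). -/
theorem gapMonoQ_three_of_coloop_regime (hz : z ∈ gr M) (hzc : rk M ((gr M).erase z) + 1 = rk M (gr M))
    (hu : 3 < u) (hR : u + 3 ≤ rk (M ＼ ({z} : Set α)) (gr (M ＼ ({z} : Set α))))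
    (h1 : ProfileIneqMinusQ (M ＼ ({z} : Set α)) 3 (u - 1)) : GapMonoQ M z 3 u :=
  gapMonoQ_of_coloop_regime hz hzc (by norm_num) hu hR h1
    (profileIneqMinusQ_two_all (M ＼ ({z} : Set α)) (u - 1) (by omega))

/-- **The row `(q, u)` of `M` at a coloop in the regime**, from three rows of `M ∖ z` — `(q, u)`, `(q, u−1)`,
`(q−1, u−1)` — the shape a strong induction on `#E` uses. -/
theorem profileIneqMinusQ_of_coloop_regime (hz : z ∈ gr M) (hzc : rk M ((gr M).erase z) + 1 = rk M (gr M))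
    (hq : 1 ≤ q) (hqu : q < u) (hR : u + q ≤ rk (M ＼ ({z} : Set α)) (gr (M ＼ ({z} : Set α))))
    (h0 : ProfileIneqMinusQ (M ＼ ({z} : Set α)) q u)
    (h1 : ProfileIneqMinusQ (M ＼ ({z} : Set α)) q (u - 1))
    (h2 : ProfileIneqMinusQ (M ＼ ({z} : Set α)) (q - 1) (u - 1)) : ProfileIneqMinusQ M q u :=
  profileIneqMinusQ_of_gapMonoQ (gapMonoQ_of_coloop_regime hz hzc hq hqu hR h1 h2) h0

end Coloop

end PercRepro.Cogirth
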